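import Mathlib.Geometry.Manifold.VectorField.Pullback
import Literature.Geometry.Lorentzian.CauchyDevelopment
import Literature.Geometry.Lorentzian.CausalityAchronalProofs
import Literature.Geometry.Lorentzian.LocalIsometryJetRigidity
import Literature.Geometry.Manifold.InverseFunctionTheorem
import HarnessLib

/-!
# An isometric immersion between globally hyperbolic developments of the same data is injective
# (Sbierski 2016, Lemma 3.2 = arXiv Lemma 9)

J. Sbierski, *On the existence of a maximal Cauchy development for the Einstein equations: a
dezornification*, Ann. Henri Poincaré 17 (2016) = arXiv:1309.7591, §3.1, Lemma 3.2 (Lemma 9 of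
the arXiv version): *"Say `(M, g)` and `(M', g')` are two globally hyperbolic spacetimes with
Cauchy surfaces `Σ` and `Σ'`, respectively. Let `ψ : M → M'` be an isometric immersion such that
`ψ|_Σ : Σ → Σ'` is a diffeomorphism. Then `ψ` is an isometric embedding. … It suffices to show
that `ψ` is injective."* This is the step of the existence proof of the MCGHD/MGHD which turns
the glued isometric immersion `U = ⋃ U_α → M'` into an embedding ("Moreover, it is clear that `ψ`
is a local isometry, and by Lemma 3.2, also a smooth embedding").

Main results: `CauchyDevelopment.injective_of_isIsometricImmersion` — for Cauchy developments
`𝒟`, `𝒟'` of the same data and `ψ : M → M'` an isometric immersion preserving the time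
orientation with `ψ ∘ ι = ι'`, `ψ` is injective; `CauchyDevelopment.embedsInto_of_isIsometricImmersion`
— hence (inverse function theorem) such a `ψ` is an embedding of developments, `𝒟 ≼ 𝒟'`.

Proof. The printed proof transports inextendible timelike *geodesics*. We run the same argument
with the maximal integral curves of the **pulled-back orienting field** `Y = ψ^* T'` (Mathlib's
`VectorField.mpullback`; `dψ` is invertible, `DataEmbedding.isInvertible_mfderiv_of_isIsometricImmersion`),
which is `C¹` (`ContMDiff.mpullback_vectorField`), timelike (`g(Y,Y) = g'(T',T')`) and
future-directed (`g(T, Y) = g'(dψ T, T') < 0` as `dψ T` is future-directed) — a shorter road in the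
present library, where maximal integral curves of timelike fields are known to be endless timelike
curves (`IntegralCurve.exists_isFutureEndless` / `exists_isPastEndless` of
`CausalityAchronalProofs`, glued here in
`LorentzianMetric.exists_isEndlessTimelikeCurve_isMIntegralCurveAt`) while the endlessness of
maximal geodesics is not yet available. If `ψ p = ψ q`, the maximal integral curves `σ`, `γ` of `Y`
through `p`, `q` are mapped by `ψ` to integral curves of `T'` through one point
(`isMIntegralCurveAt_comp_of_mpullback`), which agree on their common parameter interval
(`IntegralCurve.eqOn_of_isOpen_ordConnected`) and glue to one future timelike curve `κ` of `M'`;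
`γ`, `σ` cross `ι(X)` at parameters `τ₀`, `τ₁` (global hyperbolicity of `M`), where `κ` crosses
`ι'(X)`, so `τ₀ = τ₁` (`IsCauchyHypersurface.eq_of_mem_of_mem`: a timelike curve of `M'` meets
`ι'(X)` at most once); since `ψ ∘ ι = ι'` is injective, `γ τ₀ = σ τ₀`, whence `γ = σ` on the
common interval by uniqueness of integral curves, and `p = σ 0 = γ 0 = q` — exactly the skeleton
of the printed proof with "geodesic" replaced by "integral curve of `Y`".

All results proved; no definitions, no named facts.

## References

* J. Sbierski, Ann. Henri Poincaré 17 (2016) 301–329 = arXiv:1309.7591, §3.1, Lemma 3.2.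
* B. O'Neill, *Semi-Riemannian geometry*, 1983, Ch. 1, Lemma 56 and Ch. 14, Prop. 31 (maximal
  integral curves), Ch. 14, Lemma 29 (achronality of Cauchy hypersurfaces), Ch. 3, p. 58, Ch. 5,
  p. 145.
-/

noncomputable section

open Bundle Set Function Filter TopologicalSpace Topology VectorField
open scoped Manifold ContDiff Topology

namespace Literature.Geometry.Lorentzian

/-! ### Maximal integral curves of a future timelike field are endless timelike curves -/

section IntegralCurves

variable {E : Type*} [NormedAddCommGroup E] [NormedSpace ℝ E] {H : Type*} [TopologicalSpace H]
  {I : ModelWithCorners ℝ E H} {n : ℕ∞ω} {M : Type*} [TopologicalSpace M] [ChartedSpace H M]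
  [IsManifold I ∞ M] [T2Space M] [BoundarylessManifold I M] [CompleteSpace E]

namespace LorentzianMetric

variable (g : LorentzianMetric I n M) (τ : TimeOrientation g)

/-- **Through every point passes an endless timelike curve which is an integral curve of a given
`C¹` future-directed timelike vector field** (its maximal integral curve): glue the maximal
forward and backward integral curves through the point (`IntegralCurve.exists_isFutureEndless`,
`IntegralCurve.exists_isPastEndless`; they agree near the initial parameter by uniqueness); an
integral curve of a future timelike field is a future timelike curve. O'Neill 1983, Ch. 14,
proof of Prop. 31 (p. 417: "maximal integral curves of `X` are inextendible") with Ch. 1,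
Lemma 56. [cite: ONeillSemiRiemannian1983, Ch. 14, Prop. 31 (proof, p. 417)] -/
theorem exists_isEndlessTimelikeCurve_isMIntegralCurveAt {X : Π x : M, TangentSpace I x}
    (hX : ContMDiff I I.tangent 1 (fun x ↦ (⟨x, X x⟩ : TangentBundle I M)))
    (hXt : ∀ x, g.IsTimelike (X x)) (hXf : ∀ x, τ.IsFutureDirected (X x)) (q : M) :
    ∃ (Γ : ℝ → M) (D : Set ℝ), g.IsEndlessTimelikeCurve τ Γ D ∧ IsOpen D ∧ (0 : ℝ) ∈ D ∧
      Γ 0 = q ∧ ∀ t ∈ D, IsMIntegralCurveAt Γ X t := by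
  classical
  have hX0 : ∀ x, X x ≠ 0 := fun x ↦ (hXf x).1.2
  obtain ⟨Γp, Dp, hDp, hΓp0, hΓpint, hΓpend⟩ := IntegralCurve.exists_isFutureEndless hX hX0 q 0
  obtain ⟨Γm, Dm, hDm, hΓm0, hΓmint, hΓmend⟩ := IntegralCurve.exists_isPastEndless hX hX0 q 0
  have h0p : (0 : ℝ) ∈ Dp := by
    rcases hDp with rfl | ⟨c, hc, rfl⟩
    · exact self_mem_Ici
    · exact ⟨le_rfl, hc⟩
  have h0m : (0 : ℝ) ∈ Dm := by
    rcases hDm with rfl | ⟨c, hc, rfl⟩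
    · exact self_mem_Iic
    · exact ⟨hc, le_rfl⟩
  have hDp0 : ∀ t ∈ Dp, 0 ≤ t := fun t ht ↦ by
    rcases hDp with rfl | ⟨c, hc, rfl⟩
    · exact ht
    · exact ht.1
  have hDm0 : ∀ t ∈ Dm, t ≤ 0 := fun t ht ↦ by
    rcases hDm with rfl | ⟨c, hc, rfl⟩
    · exact ht
    · exact ht.2
  -- the two maximal half-curves agree near `0`
  have heq0 : Γm =ᶠ[𝓝 0] Γp :=
    isMIntegralCurveAt_eventuallyEq_of_contMDiffAt_boundaryless hX.contMDiffAt (hΓmint 0 h0m)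
      (hΓpint 0 h0p) (hΓm0.trans hΓp0.symm)
  -- the glued curve
  set Γ : ℝ → M := fun t ↦ if t ≤ 0 then Γm t else Γp t with hΓ
  have hΓle : ∀ t, t ≤ 0 → Γ t = Γm t := fun t ht ↦ by simp only [hΓ, if_pos ht]
  have hΓge : ∀ t, 0 ≤ t → Γ t = Γp t := fun t ht ↦ by
    rcases eq_or_lt_of_le ht with rfl | hlt
    · simp only [hΓ, if_pos le_rfl]; exact hΓm0.trans hΓp0.symm
    · simp only [hΓ, if_neg (not_le.2 hlt)]
  have hΓ0 : Γ 0 = q := (hΓle 0 le_rfl).trans hΓm0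
  -- germs of the glued curve
  have hgm : ∀ t, t ≤ 0 → Γ =ᶠ[𝓝 t] Γm := fun t ht ↦ by
    rcases eq_or_lt_of_le ht with rfl | hlt
    · filter_upwards [heq0] with t' ht'
      by_cases h : t' ≤ 0
      · exact hΓle t' h
      · rw [hΓge t' (not_le.1 h).le, ht']
    · filter_upwards [Iio_mem_nhds hlt] with t' ht'
      exact hΓle t' (le_of_lt ht')
  have hgp : ∀ t, 0 ≤ t → Γ =ᶠ[𝓝 t] Γp := fun t ht ↦ by
    rcases eq_or_lt_of_le ht with rfl | hlt
    · filter_upwards [heq0] with t' ht'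
      by_cases h : t' ≤ 0
      · rw [hΓle t' h, ht']
      · exact hΓge t' (not_le.1 h).le
    · filter_upwards [Ioi_mem_nhds hlt] with t' ht'
      exact hΓge t' (le_of_lt ht')
  -- integral curve on `D = Dm ∪ Dp`
  have hint : ∀ t ∈ Dm ∪ Dp, IsMIntegralCurveAt Γ X t := by
    rintro t (ht | ht)
    · exact IntegralCurve.isMIntegralCurveAt_congr (hΓmint t ht) (hgm t (hDm0 t ht))
    · exact IntegralCurve.isMIntegralCurveAt_congr (hΓpint t ht) (hgp t (hDp0 t ht))
  -- the domain is an open interval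
  have hDopen : IsOpen (Dm ∪ Dp) ∧ (Dm ∪ Dp).OrdConnected := by
    rcases hDm with rfl | ⟨c', hc', rfl⟩ <;> rcases hDp with rfl | ⟨c, hc, rfl⟩
    · rw [Iic_union_Ici]; exact ⟨isOpen_univ, ordConnected_univ⟩
    · rw [Iic_union_Ico_eq_Iio hc]; exact ⟨isOpen_Iio, ordConnected_Iio⟩
    · rw [Ioc_union_Ici_eq_Ioi hc']; exact ⟨isOpen_Ioi, ordConnected_Ioi⟩
    · rw [Ioc_union_Ico_eq_Ioo hc' hc]; exact ⟨isOpen_Ioo, ordConnected_Ioo⟩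
  refine ⟨Γ, Dm ∪ Dp, ⟨hDopen.2, fun t ht ↦ ?_, ?_, ?_⟩, hDopen.1, Or.inr h0p, hΓ0, hint⟩
  · -- future timelike: an integral curve of a future timelike field
    exact futureTimelikeAt_of_hasMFDerivAt rfl (hint t ht).hasMFDerivAt (hXt _) (hXf _)
  · -- future endless: a future endpoint would be one of the maximal forward curve
    refine ⟨⟨0, Or.inr h0p⟩, fun p hp ↦ hΓpend.2 p ?_⟩
    have h1 : HasFutureEndpoint Γ Dp p :=
      (hasFutureEndpoint_congr_set (γ := Γ) (Or.inr h0p) h0p (fun t ht ↦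
        ⟨fun h ↦ h.elim (fun hm ↦ (le_antisymm (hDm0 t hm) ht) ▸ h0p) id, fun h ↦ Or.inr h⟩) p).1
        hp
    exact h1.congr fun t ↦ hΓge t (hDp0 t t.2)
  · refine ⟨⟨0, Or.inl h0m⟩, fun p hp ↦ hΓmend.2 p ?_⟩
    have h1 : HasPastEndpoint Γ Dm p :=
      (hasPastEndpoint_congr_set (γ := Γ) (Or.inl h0m) h0m (fun t ht ↦
        ⟨fun h ↦ h.elim id fun hp' ↦ (le_antisymm ht (hDp0 t hp')) ▸ h0m, fun h ↦ Or.inl h⟩)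
        p).1 hp
    exact h1.congr fun t ↦ hΓle t (hDm0 t t.2)

end LorentzianMetric

omit [CompleteSpace E] in
/-- **Uniqueness of integral curves on an open interval**: two integral curves (at every
parameter) of a `C¹` field on an open interval which agree at one parameter agree on the whole
interval (Mathlib's `isMIntegralCurveOn_Ioo_eqOn_of_contMDiff_boundaryless` on bounded open
subintervals). O'Neill 1983, Ch. 1, Lemma 1.56 / Cor. 50. [cite: ONeillSemiRiemannian1983, Ch. 1, Lemma 56] -/
theorem IntegralCurve.eqOn_of_isOpen_ordConnected {X : Π x : M, TangentSpace I x}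
    (hX : ContMDiff I I.tangent 1 (fun x ↦ (⟨x, X x⟩ : TangentBundle I M))) {γ γ' : ℝ → M}
    {s : Set ℝ} (hs : IsOpen s) (hs' : s.OrdConnected) (hγ : ∀ t ∈ s, IsMIntegralCurveAt γ X t)
    (hγ' : ∀ t ∈ s, IsMIntegralCurveAt γ' X t) {t₀ : ℝ} (ht₀ : t₀ ∈ s) (h : γ t₀ = γ' t₀) :
    EqOn γ γ' s := by
  intro t ht
  -- an open bounded interval of `s` containing `t₀` and `t`
  set a := min t₀ t with ha
  set b := max t₀ t with hb
  have has : a ∈ s := by rcases min_choice t₀ t with h' | h' <;> rw [ha, h'] <;> assumption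
  have hbs : b ∈ s := by rcases max_choice t₀ t with h' | h' <;> rw [hb, h'] <;> assumption
  obtain ⟨εa, hεa, hεas⟩ := Metric.mem_nhds_iff.1 (hs.mem_nhds has)
  obtain ⟨εb, hεb, hεbs⟩ := Metric.mem_nhds_iff.1 (hs.mem_nhds hbs)
  have ha' : a - εa / 2 ∈ s := hεas (by rw [Real.ball_eq_Ioo]; exact ⟨by linarith, by linarith⟩)
  have hb' : b + εb / 2 ∈ s := hεbs (by rw [Real.ball_eq_Ioo]; exact ⟨by linarith, by linarith⟩)
  have hsub : Ioo (a - εa / 2) (b + εb / 2) ⊆ s := fun x hx ↦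
    hs'.out ha' hb' ⟨hx.1.le, hx.2.le⟩
  have hab : a ≤ b := min_le_max
  have ht₀I : t₀ ∈ Ioo (a - εa / 2) (b + εb / 2) :=
    ⟨by linarith [min_le_left t₀ t], by linarith [le_max_left t₀ t]⟩
  have htI : t ∈ Ioo (a - εa / 2) (b + εb / 2) :=
    ⟨by linarith [min_le_right t₀ t], by linarith [le_max_right t₀ t]⟩
  have h1 : IsMIntegralCurveOn γ X (Ioo (a - εa / 2) (b + εb / 2)) :=
    IsMIntegralCurveAt.isMIntegralCurveOn fun t ht ↦ hγ t (hsub ht)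
  have h2 : IsMIntegralCurveOn γ' X (Ioo (a - εa / 2) (b + εb / 2)) :=
    IsMIntegralCurveAt.isMIntegralCurveOn fun t ht ↦ hγ' t (hsub ht)
  exact isMIntegralCurveOn_Ioo_eqOn_of_contMDiff_boundaryless ht₀I hX h1 h2 h htI

namespace LorentzianMetric

omit [CompleteSpace E] in
/-- **At most one crossing of a Cauchy hypersurface** by a future timelike curve on a parameter
interval (Hausdorff, second countable, without boundary, finite-dimensional, `C²`): a timelike
segment from `S` to `S` would extend to an endless timelike curve meeting `S` twice
(`exists_isEndlessTimelikeCurve_extends`). O'Neill 1983, Ch. 14, Lemma 14.29 (achronality).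
[cite: ONeillSemiRiemannian1983, Ch. 14, Lemma 29 (p. 415)] -/
theorem IsCauchyHypersurface.eq_of_mem_of_mem [SecondCountableTopology M] [FiniteDimensional ℝ E]
    {g : LorentzianMetric I n M} {τ : TimeOrientation g} (hn : 2 ≤ n) {S : Set M}
    (hS : g.IsCauchyHypersurface τ S) {γ : ℝ → M} {s : Set ℝ} (hs : s.OrdConnected)
    (hγ : g.IsFutureTimelikeCurveOn τ γ s) {t₁ t₂ : ℝ} (ht₁ : t₁ ∈ s) (ht₂ : t₂ ∈ s)
    (h₁ : γ t₁ ∈ S) (h₂ : γ t₂ ∈ S) : t₁ = t₂ := by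
  by_contra hne
  wlog hlt : t₁ < t₂ generalizing t₁ t₂
  · exact this ht₂ ht₁ h₂ h₁ (Ne.symm hne) (lt_of_le_of_ne (not_lt.1 hlt) (Ne.symm hne))
  obtain ⟨Δ, D, hΔ, h₁D, h₂D, hΔ₁, hΔ₂⟩ :=
    exists_isEndlessTimelikeCurve_extends hn hlt (hγ.mono (hs.out ht₁ ht₂))
  obtain ⟨t, -, huniq⟩ := hS Δ D hΔ
  have e₁ := huniq t₁ ⟨h₁D, by rw [hΔ₁]; exact h₁⟩
  have e₂ := huniq t₂ ⟨h₂D, by rw [hΔ₂]; exact h₂⟩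
  exact hne (e₁.trans e₂.symm)

end LorentzianMetric

end IntegralCurves

/-! ### The pulled-back orienting field and the injectivity theorem -/

section Injective

universe u

variable {n : ℕ} {X : Type u} [TopologicalSpace X] [ChartedSpace (EuclideanSpace ℝ (Fin n)) X]
  [IsManifold (𝓡 n) ∞ X] [ConnectedSpace X] {D : InitialDataSet (𝓡 n) X}

namespace DataEmbedding

variable {𝒮 𝒮' : DataEmbedding D} {ψ : 𝒮.carrier → 𝒮'.carrier}

/-- The differential of an isometric immersion between the (equidimensional) spacetimes of two
data embeddings is invertible (injective by nondegeneracy, surjective by dimension). O'Neill 1983,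
Ch. 3, p. 58. [cite: ONeillSemiRiemannian1983, Ch. 3, p. 58] -/
theorem isInvertible_mfderiv_of_isIsometricImmersion
    (hψ : 𝒮.metric.IsIsometricImmersion 𝒮'.metric.toPseudoRiemannianMetric ψ) (x : 𝒮.carrier) :
    (mfderiv (𝓡 (n + 1)) (𝓡 (n + 1)) ψ x).IsInvertible := by
  have key : ∀ u w : EuclideanSpace ℝ (Fin (n + 1)),
      𝒮'.metric.val (ψ x) (mfderiv (𝓡 (n + 1)) (𝓡 (n + 1)) ψ x u)
        (mfderiv (𝓡 (n + 1)) (𝓡 (n + 1)) ψ x w) = 𝒮.metric.val x u w := fun u w ↦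
    DFunLike.congr_fun (DFunLike.congr_fun (hψ.2 x) u) w
  exact JetRigidity.isInvertible_of_bijective (F := EuclideanSpace ℝ (Fin (n + 1)))
    (G := EuclideanSpace ℝ (Fin (n + 1)))
    (JetRigidity.bijective_of_map_eq (E := EuclideanSpace ℝ (Fin (n + 1)))
      (F := EuclideanSpace ℝ (Fin (n + 1)))
      (q₁ := (𝒮.metric.val x : EuclideanSpace ℝ (Fin (n + 1)) →L[ℝ]
        EuclideanSpace ℝ (Fin (n + 1)) →L[ℝ] ℝ))
      (q₂ := (𝒮'.metric.val (ψ x) : EuclideanSpace ℝ (Fin (n + 1)) →L[ℝ]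
        EuclideanSpace ℝ (Fin (n + 1)) →L[ℝ] ℝ))
      (A := (mfderiv (𝓡 (n + 1)) (𝓡 (n + 1)) ψ x : EuclideanSpace ℝ (Fin (n + 1)) →L[ℝ]
        EuclideanSpace ℝ (Fin (n + 1)))) rfl (𝒮.metric.nondegenerate x) key)

/-- The pulled-back orienting field `Y = ψ^* T'` (Mathlib's `VectorField.mpullback`) is mapped
by `dψ` to `T'`. [folklore] -/
theorem mfderiv_mpullback_vectorField
    (hψ : 𝒮.metric.IsIsometricImmersion 𝒮'.metric.toPseudoRiemannianMetric ψ) (x : 𝒮.carrier) :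
    mfderiv (𝓡 (n + 1)) (𝓡 (n + 1)) ψ x
        (mpullback (𝓡 (n + 1)) (𝓡 (n + 1)) ψ 𝒮'.timeOrientation.vectorField x) =
      𝒮'.timeOrientation.vectorField (ψ x) := by
  rw [mpullback_apply]
  exact (((isInvertible_mfderiv_of_isIsometricImmersion hψ x).inverse_apply_eq).1 rfl).symm

/-- **The pulled-back orienting field is timelike**: `g(Y, Y) = g'(dψ Y, dψ Y) = g'(T', T') < 0`.
[folklore] -/
theorem isTimelike_mpullback_vectorField
    (hψ : 𝒮.metric.IsIsometricImmersion 𝒮'.metric.toPseudoRiemannianMetric ψ) (x : 𝒮.carrier) :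
    𝒮.metric.IsTimelike (mpullback (𝓡 (n + 1)) (𝓡 (n + 1)) ψ 𝒮'.timeOrientation.vectorField x) := by
  have h := DFunLike.congr_fun (DFunLike.congr_fun (hψ.2 x)
    (mpullback (𝓡 (n + 1)) (𝓡 (n + 1)) ψ 𝒮'.timeOrientation.vectorField x))
    (mpullback (𝓡 (n + 1)) (𝓡 (n + 1)) ψ 𝒮'.timeOrientation.vectorField x)
  rw [pullbackBilin_apply, mfderiv_mpullback_vectorField hψ x] at h
  change 𝒮.metric.val x _ _ < 0
  rw [← h]
  exact 𝒮'.timeOrientation.isTimelike (ψ x)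

/-- **The pulled-back orienting field is future-directed** when `ψ` preserves the time
orientation: `g(T, Y) = g'(dψ T, T') < 0` because `dψ T` is future-directed for `τ'`.
O'Neill 1983, Ch. 5, p. 145 (timecones: `g(u, v) < 0` for `u`, `v` in the same cone).
[cite: ONeillSemiRiemannian1983, Ch. 5, Lemma 26 ff. (p. 145)] -/
theorem isFutureDirected_mpullback_vectorField
    (hψ : 𝒮.metric.IsIsometricImmersion 𝒮'.metric.toPseudoRiemannianMetric ψ)
    (hτ : 𝒮.timeOrientation.PreservesTimeOrientation ψ 𝒮'.timeOrientation) (x : 𝒮.carrier) :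
    𝒮.timeOrientation.IsFutureDirected
      (mpullback (𝓡 (n + 1)) (𝓡 (n + 1)) ψ 𝒮'.timeOrientation.vectorField x) := by
  have ht := isTimelike_mpullback_vectorField hψ x
  refine ⟨⟨le_of_lt ht, fun h0 ↦ ?_⟩, ?_⟩
  · -- `Y x ≠ 0` since `g(Y, Y) < 0`
    have ht' : 𝒮.metric.val x
        (mpullback (𝓡 (n + 1)) (𝓡 (n + 1)) ψ 𝒮'.timeOrientation.vectorField x)
        (mpullback (𝓡 (n + 1)) (𝓡 (n + 1)) ψ 𝒮'.timeOrientation.vectorField x) < 0 := ht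
    rw [h0, map_zero] at ht'
    exact (lt_irrefl (0 : ℝ)) ht'
  · -- `g(T, Y) = g'(dψ T, T') < 0`
    have h := DFunLike.congr_fun (DFunLike.congr_fun (hψ.2 x) (𝒮.timeOrientation.vectorField x))
      (mpullback (𝓡 (n + 1)) (𝓡 (n + 1)) ψ 𝒮'.timeOrientation.vectorField x)
    rw [pullbackBilin_apply, mfderiv_mpullback_vectorField hψ x] at h
    change 𝒮.metric.val x _ _ < 0
    rw [← h, 𝒮'.metric.symm]
    exact (hτ x).2

/-- **The pulled-back orienting field is `C¹`** (Mathlib's `ContMDiff.mpullback_vectorField`: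
pullback of the smooth field `T'` along the smooth map `ψ` with invertible differential).
[folklore] -/
theorem contMDiff_mpullback_vectorField
    (hψ : 𝒮.metric.IsIsometricImmersion 𝒮'.metric.toPseudoRiemannianMetric ψ) :
    ContMDiff (𝓡 (n + 1)) (𝓡 (n + 1)).tangent 1 (fun x ↦
      (⟨x, mpullback (𝓡 (n + 1)) (𝓡 (n + 1)) ψ 𝒮'.timeOrientation.vectorField x⟩ :
        TangentBundle (𝓡 (n + 1)) 𝒮.carrier)) :=
  ContMDiff.mpullback_vectorField (m := 1) (n := 2)
    (𝒮'.timeOrientation.contMDiff.of_le (by simp))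
    (hψ.1.of_le (WithTop.coe_le_coe.mpr le_top : (2 : ℕ∞ω) ≤ ∞))
    (isInvertible_mfderiv_of_isIsometricImmersion hψ) (one_add_one_eq_two (R := ℕ∞ω)).le

/-- `ψ` maps integral curves of the pulled-back field `Y = ψ^* T'` to integral curves of `T'`
(chain rule, `dψ Y = T'`). [folklore] -/
theorem isMIntegralCurveAt_comp_of_mpullback
    (hψ : 𝒮.metric.IsIsometricImmersion 𝒮'.metric.toPseudoRiemannianMetric ψ) {γ : ℝ → 𝒮.carrier}
    {t : ℝ}
    (hγ : IsMIntegralCurveAt γ (mpullback (𝓡 (n + 1)) (𝓡 (n + 1)) ψ 𝒮'.timeOrientation.vectorField) t) :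
    IsMIntegralCurveAt (ψ ∘ γ) 𝒮'.timeOrientation.vectorField t := by
  have hψd : MDifferentiable (𝓡 (n + 1)) (𝓡 (n + 1)) ψ := hψ.1.mdifferentiable (by simp)
  filter_upwards [hγ] with s hs
  have hc := (hψd (γ s)).hasMFDerivAt.comp s hs
  have heq : (mfderiv (𝓡 (n + 1)) (𝓡 (n + 1)) ψ (γ s)).comp
      ((1 : ℝ →L[ℝ] ℝ).smulRight
        (mpullback (𝓡 (n + 1)) (𝓡 (n + 1)) ψ 𝒮'.timeOrientation.vectorField (γ s))) =
      (1 : ℝ →L[ℝ] ℝ).smulRight (𝒮'.timeOrientation.vectorField ((ψ ∘ γ) s)) := by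
    apply ContinuousLinearMap.ext_ring
    change mfderiv (𝓡 (n + 1)) (𝓡 (n + 1)) ψ (γ s)
        ((1 : ℝ) • mpullback (𝓡 (n + 1)) (𝓡 (n + 1)) ψ 𝒮'.timeOrientation.vectorField (γ s)) =
      (1 : ℝ) • 𝒮'.timeOrientation.vectorField (ψ (γ s))
    rw [one_smul, one_smul]
    exact mfderiv_mpullback_vectorField hψ (γ s)
  exact hc.congr_mfderiv heq

end DataEmbedding

namespace CauchyDevelopment

/-- **An isometric immersion between globally hyperbolic developments of the same data which
preserves the time orientation and commutes with the embeddings of the data is injective**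
(Sbierski 2016, Lemma 3.2 = arXiv Lemma 9: "Then `ψ` is an isometric embedding … It suffices to
show that `ψ` is injective"). The printed proof transports inextendible timelike *geodesics*; we
run the same argument with the maximal integral curves of the pulled-back orienting field
`Y = ψ^* T'` (a shorter road in the present library, which has maximal integral curves of timelike
fields as endless timelike curves but not yet the endlessness of maximal geodesics): if
`ψ p = ψ q`, the maximal integral curves `σ`, `γ` of `Y` through `p`, `q` are mapped to integral
curves of `T'` through the same point, which therefore agree on their common parameter interval
and glue to one future timelike curve `κ` of `M'`; `γ` and `σ` cross the Cauchy hypersurface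
`ι(X)` at parameters `τ₀`, `τ₁` (global hyperbolicity of `M`), where `κ` crosses `ι'(X)`, so
`τ₀ = τ₁` (a timelike curve of the globally hyperbolic `M'` meets `ι'(X)` at most once); as
`ψ ∘ ι = ι'` is injective, `γ τ₀ = σ τ₀`, whence `γ = σ` by uniqueness of integral curves and
`p = σ 0 = γ 0 = q`. [cite: Sbierski2016AHP, §3.1, Lemma 3.2 (arXiv: Lemma 9)] -/
theorem injective_of_isIsometricImmersion (𝒟 𝒟' : CauchyDevelopment D)
    {ψ : 𝒟.carrier → 𝒟'.carrier}
    (hψ : 𝒟.metric.IsIsometricImmersion 𝒟'.metric.toPseudoRiemannianMetric ψ)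
    (hτ : 𝒟.timeOrientation.PreservesTimeOrientation ψ 𝒟'.timeOrientation)
    (hι : ψ ∘ 𝒟.embed = 𝒟'.embed) : Injective ψ := by
  classical
  intro p q hpq
  have hn2 : (2 : ℕ∞ω) ≤ ∞ := WithTop.coe_le_coe.mpr le_top
  set T' := 𝒟'.timeOrientation.vectorField with hT'def
  have hT' : ContMDiff (𝓡 (n + 1)) (𝓡 (n + 1)).tangent 1
      (fun x ↦ (⟨x, T' x⟩ : TangentBundle (𝓡 (n + 1)) 𝒟'.carrier)) :=
    𝒟'.timeOrientation.contMDiff.of_le (by simp)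
  -- the pulled-back orienting field on `M`
  set Y := mpullback (𝓡 (n + 1)) (𝓡 (n + 1)) ψ T' with hYdef
  have hY : ContMDiff (𝓡 (n + 1)) (𝓡 (n + 1)).tangent 1
      (fun x ↦ (⟨x, Y x⟩ : TangentBundle (𝓡 (n + 1)) 𝒟.carrier)) :=
    DataEmbedding.contMDiff_mpullback_vectorField hψ
  have hYt : ∀ x, 𝒟.metric.IsTimelike (Y x) :=
    DataEmbedding.isTimelike_mpullback_vectorField hψ
  have hYf : ∀ x, 𝒟.timeOrientation.IsFutureDirected (Y x) :=
    DataEmbedding.isFutureDirected_mpullback_vectorField hψ hτ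
  -- maximal integral curves of `Y` through `q` and `p`
  obtain ⟨γ, Dγ, hγ, hDγo, h0γ, hγ0, hγint⟩ :=
    𝒟.metric.exists_isEndlessTimelikeCurve_isMIntegralCurveAt 𝒟.timeOrientation hY hYt hYf q
  obtain ⟨σ, Dσ, hσ, hDσo, h0σ, hσ0, hσint⟩ :=
    𝒟.metric.exists_isEndlessTimelikeCurve_isMIntegralCurveAt 𝒟.timeOrientation hY hYt hYf p
  -- their images are integral curves of `T'` through `ψ q = ψ p`, hence agree on `Dγ ∩ Dσ`
  have hγ' : ∀ t ∈ Dγ, IsMIntegralCurveAt (ψ ∘ γ) T' t := fun t ht ↦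
    DataEmbedding.isMIntegralCurveAt_comp_of_mpullback hψ (hγint t ht)
  have hσ' : ∀ t ∈ Dσ, IsMIntegralCurveAt (ψ ∘ σ) T' t := fun t ht ↦
    DataEmbedding.isMIntegralCurveAt_comp_of_mpullback hψ (hσint t ht)
  have hagree : EqOn (ψ ∘ γ) (ψ ∘ σ) (Dγ ∩ Dσ) :=
    IntegralCurve.eqOn_of_isOpen_ordConnected hT' (hDγo.inter hDσo) (hγ.1.inter hσ.1)
      (fun t ht ↦ hγ' t ht.1) (fun t ht ↦ hσ' t ht.2) ⟨h0γ, h0σ⟩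
      (by simp only [comp_apply, hγ0, hσ0, hpq])
  -- the glued curve `κ` of `M'`
  set κ : ℝ → 𝒟'.carrier := fun t ↦ if t ∈ Dγ then ψ (γ t) else ψ (σ t) with hκ
  have hκγ : ∀ t ∈ Dγ, κ t = ψ (γ t) := fun t ht ↦ by simp only [hκ, if_pos ht]
  have hκσ : ∀ t ∈ Dσ, κ t = ψ (σ t) := fun t ht ↦ by
    by_cases h : t ∈ Dγ
    · rw [hκγ t h]; exact hagree ⟨h, ht⟩
    · simp only [hκ, if_neg h]
  have hκγ' : ∀ t ∈ Dγ, κ =ᶠ[𝓝 t] (ψ ∘ γ) := fun t ht ↦ by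
    filter_upwards [hDγo.mem_nhds ht] with t' ht'
    exact hκγ t' ht'
  have hκσ' : ∀ t ∈ Dσ, κ =ᶠ[𝓝 t] (ψ ∘ σ) := fun t ht ↦ by
    filter_upwards [hDσo.mem_nhds ht] with t' ht'
    exact hκσ t' ht'
  have hκint : ∀ t ∈ Dγ ∪ Dσ, IsMIntegralCurveAt κ T' t := by
    rintro t (ht | ht)
    · exact IntegralCurve.isMIntegralCurveAt_congr (hγ' t ht) (hκγ' t ht)
    · exact IntegralCurve.isMIntegralCurveAt_congr (hσ' t ht) (hκσ' t ht)
  have hκt : 𝒟'.metric.IsFutureTimelikeCurveOn 𝒟'.timeOrientation κ (Dγ ∪ Dσ) := fun t ht ↦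
    LorentzianMetric.futureTimelikeAt_of_hasMFDerivAt rfl (hκint t ht).hasMFDerivAt
      (𝒟'.timeOrientation.isTimelike _) (𝒟'.timeOrientation.isFutureDirected_vectorField _)
  have hord : (Dγ ∪ Dσ).OrdConnected :=
    isPreconnected_iff_ordConnected.1 ((isPreconnected_iff_ordConnected.2 hγ.1).union 0 h0γ h0σ
      (isPreconnected_iff_ordConnected.2 hσ.1))
  -- the crossings of the Cauchy hypersurfaces
  obtain ⟨τ₀, ⟨hτ₀D, x₀, hx₀⟩, -⟩ := 𝒟.isCauchyHypersurface γ Dγ hγ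
  obtain ⟨τ₁, ⟨hτ₁D, x₁, hx₁⟩, -⟩ := 𝒟.isCauchyHypersurface σ Dσ hσ
  have hκ₀ : κ τ₀ = 𝒟'.embed x₀ := by
    rw [hκγ τ₀ hτ₀D, ← hx₀]; exact congr_fun hι x₀
  have hκ₁ : κ τ₁ = 𝒟'.embed x₁ := by
    rw [hκσ τ₁ hτ₁D, ← hx₁]; exact congr_fun hι x₁
  have h01 : τ₀ = τ₁ :=
    LorentzianMetric.IsCauchyHypersurface.eq_of_mem_of_mem hn2 𝒟'.isCauchyHypersurface hord hκt
      (Or.inl hτ₀D) (Or.inr hτ₁D) ⟨x₀, hκ₀.symm⟩ ⟨x₁, hκ₁.symm⟩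
  subst h01
  -- `γ τ₀ = σ τ₀`, as `ψ ∘ ι = ι'` is injective
  have hx : x₀ = x₁ := 𝒟'.isSmoothEmbedding.isEmbedding.injective (hκ₀.symm.trans hκ₁)
  have hγσ : γ τ₀ = σ τ₀ := by rw [← hx₀, ← hx₁, hx]
  -- uniqueness of integral curves of `Y`: `γ = σ` on `Dγ ∩ Dσ ∋ 0`
  have heq := IntegralCurve.eqOn_of_isOpen_ordConnected hY (hDγo.inter hDσo) (hγ.1.inter hσ.1)
    (fun t ht ↦ hγint t ht.1) (fun t ht ↦ hσint t ht.2) ⟨hτ₀D, hτ₁D⟩ hγσ ⟨h0γ, h0σ⟩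
  rw [hγ0, hσ0] at heq
  exact heq.symm

/-- **An isometric immersion between globally hyperbolic developments of the same data is an
embedding of developments** (Sbierski 2016, Lemma 3.2 and the remark after Def. 2.3: "in
Definition (extension) one does not need to require `ψ` to be an isometric embedding — `ψ` being
an isometric immersion suffices"): it is injective (`injective_of_isIsometricImmersion`) and a
local diffeomorphism (inverse function theorem on manifolds,
`Literature.Geometry.Manifold.isLocalDiffeomorphAt_of_mfderiv`, its differential being invertible),
hence an open embedding. [cite: Sbierski2016AHP, §3.1, Lemma 3.2 (arXiv: Lemma 9)] -/
theorem embedsInto_of_isIsometricImmersion (𝒟 𝒟' : CauchyDevelopment D)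
    {ψ : 𝒟.carrier → 𝒟'.carrier}
    (hψ : 𝒟.metric.IsIsometricImmersion 𝒟'.metric.toPseudoRiemannianMetric ψ)
    (hτ : 𝒟.timeOrientation.PreservesTimeOrientation ψ 𝒟'.timeOrientation)
    (hι : ψ ∘ 𝒟.embed = 𝒟'.embed) : 𝒟.EmbedsInto 𝒟' := by
  have hloc : IsLocalDiffeomorph (𝓡 (n + 1)) (𝓡 (n + 1)) ∞ ψ := fun x ↦ by
    obtain ⟨e, he⟩ := DataEmbedding.isInvertible_mfderiv_of_isIsometricImmersion hψ x
    exact Literature.Geometry.Manifold.isLocalDiffeomorphAt_of_mfderiv (by simp) isOpen_univ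
      (mem_univ x) hψ.1.contMDiffOn e he.symm
  exact ⟨ψ, hψ.1, IsOpenEmbedding.of_continuous_injective_isOpenMap hψ.1.continuous
    (injective_of_isIsometricImmersion 𝒟 𝒟' hψ hτ hι) hloc.isLocalHomeomorph.isOpenMap, hψ, hτ, hι⟩

end CauchyDevelopment

end Injective

end Literature.Geometry.Lorentzian

end
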